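import Summits.Ventures.YMGap.Thresholds.ZeroCouplingResampling
import HarnessLib

/-!
# Plaquette geometry of `ℤ^d`: every neighbour of a plaquette has a PRIVATE link (row type C-SLOPE-0-G, part 6a)

Cell `pub-ymgap`, seat ds-1 (gen 15). HONEST FRAMING: pure lattice combinatorics of `ℤ^d` (every `d`), a tool for the strong-coupling
expansion around `β = 0` uniform over DLR states (the planned fourth-order one-plaquette law: the `O(β⁴)` kernel coefficient has
`dg_∞`-mean zero because a link can always be resampled). Nothing about couplings, the continuum, or Clay. 0 defs, 0 compute.

* `exists_parallel_partner`: the link of a plaquette `q` parallel to a given link `(y, k) ∈ q` — it is `(y ± e_n, k)` with `n ≠ k` the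
  other direction of `q`; the `k`-links of `q` are exactly these two, and every other link of `q` has direction `n` and base point in
  `{y, y + e_k, y ± e_n, y ± e_n + e_k}`.
* ★ `exists_private_link`: if `q ≠ p` share the link `e`, then the link `f` of `q` OPPOSITE to `e` is not a link of `p`, and the only
  plaquette containing `f` and touching `p` is `q` itself. Consequently (`exists_private_link'`) every plaquette `q ≠ p` touching `p`
  has a link lying in no other plaquette that touches `p` and not in `p`.

References (context): R. Balian, J.-M. Drouffe, C. Itzykson, PRD 11 (1975) 2104 §III (diagrams of the strong-coupling series).
-/

noncomputable section

open Finset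
open Literature.MathematicalPhysics.QuantumLattice (ZdEdge ZdPlaquette plaquetteEdges plaquettesTouching)
open Literature.MathematicalPhysics.QuantumFieldTheory hiding ZdEdge
open Literature.Probability.LatticeModels (Site)

namespace Summit.Ventures.YMGap.ZeroCouplingSlope

variable {d : ℕ}

/-- Three signed unit vectors never balance as `±e_n = ±e_m ± e_l` in `ℤ^d`. [folklore] -/
theorem single_ne_signed_sum (n m l : Fin d) {σ₁ σ₂ σ₃ : ℤ} (h1 : σ₁ = 1 ∨ σ₁ = -1) (h2 : σ₂ = 1 ∨ σ₂ = -1)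
    (h3 : σ₃ = 1 ∨ σ₃ = -1) :
    (Pi.single n σ₁ : Site d) ≠ Pi.single m σ₂ + Pi.single l σ₃ := by
  intro h
  have hn := congr_fun h n
  have hm := congr_fun h m
  have hl := congr_fun h l
  simp only [Pi.add_apply, Pi.single_apply] at hn hm hl
  by_cases hnm : n = m <;> by_cases hnl : n = l <;> by_cases hml : m = l <;> simp_all <;> omega

/-- **The parallel partner of a link in a plaquette.** For `(y, k) ∈ q` there are the other direction `n ≠ k` of `q` and the other
`k`-link `(y', k) ∈ q`, `y' = y ± e_n`; the `k`-links of `q` are exactly `y, y'`, and every link of `q` of direction `≠ k` has direction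
`n` and base point in `{y, y + e_k, y', y' + e_k}`. [folklore] -/
theorem exists_parallel_partner (q : ZdPlaquette d) {y : Site d} {k : Fin d} (h : ((y, k) : ZdEdge d) ∈ plaquetteEdges q) :
    ∃ n : Fin d, n ≠ k ∧ ∃ y' : Site d, ((y', k) : ZdEdge d) ∈ plaquetteEdges q ∧
      (y' = y + Pi.single n 1 ∨ y = y' + Pi.single n 1) ∧
      (∀ w : Site d, ((w, k) : ZdEdge d) ∈ plaquetteEdges q → w = y ∨ w = y') ∧
      (∀ (w : Site d) (l : Fin d), ((w, l) : ZdEdge d) ∈ plaquetteEdges q → l ≠ k →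
        l = n ∧ (w = y ∨ w = y + Pi.single k 1 ∨ w = y' ∨ w = y' + Pi.single k 1)) := by
  obtain ⟨z, ⟨⟨a, b⟩, hab⟩⟩ := q
  have hab' : a ≠ b := ne_of_lt hab
  rw [mk_mem_plaquetteEdges_iff] at h
  simp only at h
  -- the `k`-links and the other links of `q = (z; a < b)`, read off `mk_mem_plaquetteEdges_iff`
  have hA : ∀ w : Site d, ((w, a) : ZdEdge d) ∈ plaquetteEdges ((z, ⟨(a, b), hab⟩) : ZdPlaquette d) →
      w = z ∨ w = z + Pi.single b 1 := fun w hw => by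
    rw [mk_mem_plaquetteEdges_iff] at hw; simp only at hw
    rcases hw with ⟨-, hw⟩ | ⟨hba, -⟩
    · exact hw
    · exact absurd hba hab'.symm
  have hB : ∀ w : Site d, ((w, b) : ZdEdge d) ∈ plaquetteEdges ((z, ⟨(a, b), hab⟩) : ZdPlaquette d) →
      w = z + Pi.single a 1 ∨ w = z := fun w hw => by
    rw [mk_mem_plaquetteEdges_iff] at hw; simp only at hw
    rcases hw with ⟨hab2, -⟩ | ⟨-, hw⟩
    · exact absurd hab2 hab'
    · exact hw
  have hA' : ∀ (w : Site d) (l : Fin d), ((w, l) : ZdEdge d) ∈ plaquetteEdges ((z, ⟨(a, b), hab⟩) : ZdPlaquette d) → l ≠ a →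
      l = b ∧ (w = z + Pi.single a 1 ∨ w = z) := fun w l hw hl => by
    rw [mk_mem_plaquetteEdges_iff] at hw; simp only at hw
    rcases hw with ⟨hal, -⟩ | ⟨hbl, hw⟩
    · exact absurd hal.symm hl
    · exact ⟨hbl.symm, hw⟩
  have hB' : ∀ (w : Site d) (l : Fin d), ((w, l) : ZdEdge d) ∈ plaquetteEdges ((z, ⟨(a, b), hab⟩) : ZdPlaquette d) → l ≠ b →
      l = a ∧ (w = z ∨ w = z + Pi.single b 1) := fun w l hw hl => by
    rw [mk_mem_plaquetteEdges_iff] at hw; simp only at hw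
    rcases hw with ⟨hal, hw⟩ | ⟨hbl, -⟩
    · exact ⟨hal.symm, hw⟩
    · exact absurd hbl.symm hl
  rcases h with ⟨rfl, hy | hy⟩ | ⟨rfl, hy | hy⟩ <;> subst y
  · -- `(z, a)`: partner `(z + e_b, a)`
    refine ⟨b, hab'.symm, z + Pi.single b 1, by simp [plaquetteEdges], Or.inl rfl, hA, fun w l hw hl => ?_⟩
    obtain ⟨rfl, hw'⟩ := hA' w l hw hl
    exact ⟨rfl, by rcases hw' with rfl | rfl <;> simp⟩
  · -- `(z + e_b, a)`: partner `(z, a)`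
    refine ⟨b, hab'.symm, z, by simp [plaquetteEdges], Or.inr rfl, fun w hw => (hA w hw).symm, fun w l hw hl => ?_⟩
    obtain ⟨rfl, hw'⟩ := hA' w l hw hl
    exact ⟨rfl, by rcases hw' with rfl | rfl <;> simp⟩
  · -- `(z + e_a, b)`: partner `(z, b)`
    refine ⟨a, hab', z, by simp [plaquetteEdges], Or.inr rfl, hB, fun w l hw hl => ?_⟩
    obtain ⟨rfl, hw'⟩ := hB' w l hw hl
    exact ⟨rfl, by rcases hw' with rfl | rfl <;> simp⟩
  · -- `(z, b)`: partner `(z + e_a, b)`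
    refine ⟨a, hab', z + Pi.single a 1, by simp [plaquetteEdges], Or.inl rfl, fun w hw => (hB w hw).symm, fun w l hw hl => ?_⟩
    obtain ⟨rfl, hw'⟩ := hB' w l hw hl
    exact ⟨rfl, by rcases hw' with rfl | rfl <;> simp⟩

/-- Signed form of `y' = y ± e_j`. [folklore] -/
theorem exists_sign_of_or {y y' : Site d} {j : Fin d} (h : y' = y + Pi.single j 1 ∨ y = y' + Pi.single j 1) :
    ∃ σ : ℤ, (σ = 1 ∨ σ = -1) ∧ y' = y + Pi.single j σ := by
  rcases h with rfl | rfl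
  · exact ⟨1, Or.inl rfl, rfl⟩
  · exact ⟨-1, Or.inr rfl, by rw [add_assoc, ← Pi.single_add]; simp⟩

/-- **The core of the private-link lemma.** `p ∋ e = (y₀, k)`, `q ∋ e` with `q ≠ p`, and `f = (y₁, k)` the link of `q` opposite to
`e` (`y₁ = y₀ ± e_m`). Then `f ∉ p`, and a plaquette `q'` containing `f` and touching `p` equals `q`. [folklore] -/
theorem eq_of_mem_opposite_link {p q : ZdPlaquette d} (hqp : q ≠ p) {y₀ y₁ : Site d} {k m : Fin d} (hmk : m ≠ k)
    (hy : y₁ = y₀ + Pi.single m 1 ∨ y₀ = y₁ + Pi.single m 1) (hep : ((y₀, k) : ZdEdge d) ∈ plaquetteEdges p)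
    (heq : ((y₀, k) : ZdEdge d) ∈ plaquetteEdges q) (hfq : ((y₁, k) : ZdEdge d) ∈ plaquetteEdges q) :
    ((y₁, k) : ZdEdge d) ∉ plaquetteEdges p ∧
      ∀ q' : ZdPlaquette d, ((y₁, k) : ZdEdge d) ∈ plaquetteEdges q' →
        (∃ g ∈ plaquetteEdges q', g ∈ plaquetteEdges p) → q' = q := by
  obtain ⟨σ₂, hσ₂, hyσ⟩ := exists_sign_of_or hy
  have hne : ((y₀, k) : ZdEdge d) ≠ (y₁, k) := by
    intro h
    have h1 : y₀ = y₁ := (Prod.mk.inj h).1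
    have h2 := congr_fun hyσ m
    rw [← h1] at h2
    simp at h2
    rcases hσ₂ with rfl | rfl <;> simp at h2
  have hfp : ((y₁, k) : ZdEdge d) ∉ plaquetteEdges p := fun hf =>
    hqp (ZeroCouplingMoments.eq_of_mem_plaquetteEdges_of_ne hne heq hfq hep hf)
  refine ⟨hfp, fun q' hfq' ⟨g, hgq', hgp⟩ => ?_⟩
  obtain ⟨w, l⟩ := g
  obtain ⟨n, hnk, y₀', hy₀'p, hy₀', hpk, hpo⟩ := exists_parallel_partner p hep
  obtain ⟨m'', hm''k, y₁', hy₁'q', hy₁', hq'k, hq'o⟩ := exists_parallel_partner q' hfq'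
  obtain ⟨σ₁, hσ₁, hy₀'σ⟩ := exists_sign_of_or hy₀'
  obtain ⟨σ₃, hσ₃, hy₁'σ⟩ := exists_sign_of_or hy₁'
  by_cases hl : l = k
  · subst hl
    rcases hpk w hgp with hw | hw <;> subst w
    · -- `g = e ∈ q'`: `q' ∋ e, f` and `q ∋ e, f`
      exact ZeroCouplingMoments.eq_of_mem_plaquetteEdges_of_ne hne hgq' hfq' heq hfq
    · -- `g = (y₀', l)`, the other `l`-link of `p`, lies in `q'`: it is `f` or `f`'s partner
      rcases hq'k y₀' hgq' with h | h
      · exact absurd (h ▸ hy₀'p) hfp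
      · exfalso
        have h' : (Pi.single n σ₁ : Site d) = Pi.single m σ₂ + Pi.single m'' σ₃ := by
          have := h; rw [hy₀'σ, hy₁'σ, hyσ, add_assoc] at this; exact add_left_cancel this
        exact single_ne_signed_sum n m m'' hσ₁ hσ₂ hσ₃ h'
  · -- `g` has the other direction `l` of both `p` and `q'`
    obtain ⟨hln, hw1⟩ := hpo w l hgp hl
    obtain ⟨hlm, hw2⟩ := hq'o w l hgq' hl
    subst hln
    subst hlm
    -- parametrise the two descriptions of `w`
    obtain ⟨α, a, hα, ha, hw1'⟩ : ∃ α a : ℤ, (α = 0 ∨ α = 1) ∧ (a = 0 ∨ a = 1) ∧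
        w = y₀ + Pi.single k α + Pi.single l (a * σ₁) := by
      rcases hw1 with rfl | rfl | rfl | rfl
      · exact ⟨0, 0, Or.inl rfl, Or.inl rfl, by simp⟩
      · exact ⟨1, 0, Or.inr rfl, Or.inl rfl, by simp⟩
      · exact ⟨0, 1, Or.inl rfl, Or.inr rfl, by rw [hy₀'σ]; simp⟩
      · exact ⟨1, 1, Or.inr rfl, Or.inr rfl, by rw [hy₀'σ]; simp [add_right_comm]⟩
    obtain ⟨α', a', hα', ha', hw2'⟩ : ∃ α' a' : ℤ, (α' = 0 ∨ α' = 1) ∧ (a' = 0 ∨ a' = 1) ∧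
        w = y₀ + Pi.single m σ₂ + Pi.single k α' + Pi.single l (a' * σ₃) := by
      rcases hw2 with rfl | rfl | rfl | rfl
      · exact ⟨0, 0, Or.inl rfl, Or.inl rfl, by rw [hyσ]; simp⟩
      · exact ⟨1, 0, Or.inr rfl, Or.inl rfl, by rw [hyσ]; simp⟩
      · exact ⟨0, 1, Or.inl rfl, Or.inr rfl, by rw [hy₁'σ, hyσ]; simp⟩
      · exact ⟨1, 1, Or.inr rfl, Or.inr rfl, by rw [hy₁'σ, hyσ]; simp [add_right_comm]⟩
    have H := hw1'.symm.trans hw2'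
    have Hm := congr_fun H m
    have Hk := congr_fun H k
    have Hl := congr_fun H l
    simp only [Pi.add_apply, Pi.single_apply, if_true, if_neg hmk, if_neg (Ne.symm hmk), if_neg hl, if_neg (Ne.symm hl)] at Hm Hk Hl
    by_cases hml : m = l
    · subst hml
      simp only [if_true] at Hm
      rcases ha with rfl | rfl <;> rcases ha' with rfl | rfl
      · exfalso; omega
      · -- `w` on the `f`-partner side of `q'`: the partner of `f` in `q'` is `e`, so `q' = q`
        have hs : σ₃ = -σ₂ := by omega
        refine ZeroCouplingMoments.eq_of_mem_plaquetteEdges_of_ne hne ?_ hfq' heq hfq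
        have e0 : y₁' = y₀ := by rw [hy₁'σ, hyσ, hs, add_assoc, ← Pi.single_add]; simp
        rw [← e0]; exact hy₁'q'
      · -- `w` on the `e`-partner side of `p`: `f` would be the other `k`-link of `p`
        have hs : σ₂ = σ₁ := by omega
        have e0 : y₁ = y₀' := by rw [hyσ, hy₀'σ, hs]
        exact absurd (by rw [e0]; exact hy₀'p : ((y₁, k) : ZdEdge d) ∈ plaquetteEdges p) hfp
      · exfalso; omega
    · simp only [if_neg hml] at Hm
      exfalso; omega

/-- ★ **Every neighbour of a plaquette has a private link.** If `q ≠ p` share a link `e`, then `q` has a link `f ∉ p` such that the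
only plaquette containing `f` and touching `p` is `q`. [folklore] -/
theorem exists_private_link (p q : ZdPlaquette d) (hqp : q ≠ p) {e : ZdEdge d} (hep : e ∈ plaquetteEdges p)
    (heq : e ∈ plaquetteEdges q) :
    ∃ f ∈ plaquetteEdges q, f ∉ plaquetteEdges p ∧
      ∀ q' : ZdPlaquette d, f ∈ plaquetteEdges q' → (∃ g ∈ plaquetteEdges q', g ∈ plaquetteEdges p) → q' = q := by
  obtain ⟨y₀, k⟩ := e
  obtain ⟨m, hmk, y₁, hfq, hy, -, -⟩ := exists_parallel_partner q heq
  exact ⟨(y₁, k), hfq, eq_of_mem_opposite_link hqp hmk hy hep heq hfq⟩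

/-- ★ The same in terms of `plaquettesTouching`: a plaquette `q ≠ p` touching the links of `p` has a link outside `p` that lies in
no OTHER plaquette touching the links of `p`. [folklore] -/
theorem exists_private_link_of_mem_plaquettesTouching (p q : ZdPlaquette d) (hq : q ∈ plaquettesTouching (plaquetteEdges p))
    (hqp : q ≠ p) :
    ∃ f ∈ plaquetteEdges q, f ∉ plaquetteEdges p ∧
      ∀ q' ∈ plaquettesTouching (plaquetteEdges p), q' ≠ q → f ∉ plaquetteEdges q' := by
  obtain ⟨e, he⟩ := Literature.MathematicalPhysics.QuantumLattice.mem_plaquettesTouching_iff.1 hq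
  rw [Finset.mem_inter] at he
  obtain ⟨f, hfq, hfp, hf⟩ := exists_private_link p q hqp he.2 he.1
  refine ⟨f, hfq, hfp, fun q' hq' hq'q hfq' => hq'q (hf q' hfq' ?_)⟩
  obtain ⟨g, hg⟩ := Literature.MathematicalPhysics.QuantumLattice.mem_plaquettesTouching_iff.1 hq'
  rw [Finset.mem_inter] at hg
  exact ⟨g, hg.1, hg.2⟩

end Summit.Ventures.YMGap.ZeroCouplingSlope
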